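import Mathlib
import HarnessLib
import HarnessLib.Audit
import Summits.MatrixMultiplication.Statement
import Literature.Computability.AlgebraicComplexity.MatrixMultiplicationExponent
import Literature.Computability.AlgebraicComplexity.FlatteningBound
import Literature.Computability.AlgebraicComplexity.KroneckerRank
import Literature.Computability.AlgebraicComplexity.SchoenhageTau
import HarnessLib.Audit.Status.Attr

/-!
Route: ShapeSubmodularity

CLOSED (superseded) 2026-08-17T14:08:24Z by planner-rbadge-MatrixMultiplication-ShapeSubmo-46a2e293-0 — reason: superseded:route-MatrixMultiplication-CubicExchangeSplit — superseded by route-MatrixMultiplication-CubicExchangeSplit — note: route-repair (badge, skeleton.hides-summit) verdict: CLOSE — superseded by route-MatrixMultiplication-CubicExchangeSplit. CENSUS. Thesis X = SUBMOD ∧ E has collapsed onto the summit: crux E = PerfectAmortisation (stmt-10893) CLOSED proved 2026-08-17 (Coppersmith 1982 / Lotti–Romani 1983 Prop 4.1; Th. The file is kept as the record of this route; refuted decls are indexed as negative knowledge (`ledger negatives`).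

# Route ShapeSubmodularity — matrix dimensions are substitutes — shape submodularity plus perfect
amortisation give omega = 2

X = SUBMOD ∧ E ("it suffices to show X"; realises card shape-submodularity-border-mrr2 as spine,
sharing E with card
epr-faces-amortised-module-border-rank / route EPRFaces). Put the max/min LATTICE on matrix formats:
in exponent coordinates
p = (a,b,c) the Kronecker product obeys ⟨p ∨ q⟩ ⊠ ⟨p ∧ q⟩ = ⟨p⟩ ⊠ ⟨q⟩ = ⟨p + q⟩, and h(p) :=
ω(a,b,c) = omegaRect ℂ a b c is the
support function of Strassen's spectrum of matrix shapes. SUBMOD (crux ShapeSubmodular): h is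
submodular on the integer format
lattice, h(p ∨ q) + h(p ∧ q) ≤ h(p) + h(q) — "the three dimensions are substitutes": aligning two
formats never increases total
exponent cost. E (crux PerfectAmortisation, the EPRFaces item verbatim): lim_k [ω(1,1,k) − k − 1] =
0, bulk matrix–vector
products are free. The single SUBMOD instance (k,1,1) & (1,k,1) reads ω(k,k,1) + ω ≤ 2ω(1,1,k), and
ω(k,k,1) = k·ω(1,1,1/k) ≥ 2k,
so SUBMOD gives ω ≤ 2(ω(1,1,k) − k) for every k ≥ 1 — hence ω ≤ 2β with β := lim_k (ω(1,1,k) − k) —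
and E (β = 1) closes it.
Both conjuncts are necessary (ω = 2 forces h = max of pairwise sums, which is submodular, and forces
β = 1), so X ⟺ ω(ℂ) = 2.
RANK FORM (rev 1, cone repair 2026-08-16): for natural exponents ω(a,b,c) is unfolded into its
defining O-bounds R(⟨n^a,n^b,n^c⟩) = O(n^β) (R = tensorRank, ⟨·,·,·⟩ = matMulTensor ℂ), so SUBMOD is
filed as: admissible β for p and β' for q give, for every ε > 0, admissible γ for p ∨ q and γ' for p
∧ q with γ + γ' ≤ β + β' + ε — equivalent to the omegaRect form because each admissible set is
non-empty, bounded below and upward closed (dictionary: rectDim_natCast, csInf_le / le_csInf); the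
route file thus imports neither RectangularExponent (home of the vendored VXXZ2024 / ADVXXZ2025
table facts) nor BorderRankMatMulSmall (the CHL named facts), only MatrixMultiplicationExponent,
FlatteningBound, KroneckerRank and SchoenhageTau, whose named facts are all proved in tree.
Lean: `(∀ a b c a' b' c' : ℕ, ∀ β β' : ℝ, (fun n : ℕ =>
(Literature.Computability.AlgebraicComplexity.tensorRank
(Literature.Computability.AlgebraicComplexity.matMulTensor ℂ (n ^ a) (n ^ b) (n ^ c)) : ℝ))
=O[Filter.atTop] (fun n : ℕ => (n : ℝ) ^ β) → (fun n : ℕ =>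
(Literature.Computability.AlgebraicComplexity.tensorRank
(Literature.Computability.AlgebraicComplexity.matMulTensor ℂ (n ^ a') (n ^ b') (n ^ c')) : ℝ))
=O[Filter.atTop] (fun n : ℕ => (n : ℝ) ^ β') → ∀ ε : ℝ, 0 < ε → ∃ γ γ' : ℝ, γ + γ' ≤ β + β' + ε ∧
(fun n : ℕ => (Literature.Computability.AlgebraicComplexity.tensorRank
(Literature.Computability.AlgebraicComplexity.matMulTensor ℂ (n ^ max a a') (n ^ max b b') (n ^ max
c c')) : ℝ)) =O[Filter.atTop] (fun n : ℕ => (n : ℝ) ^ γ) ∧ (fun n : ℕ =>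
(Literature.Computability.AlgebraicComplexity.tensorRank
(Literature.Computability.AlgebraicComplexity.matMulTensor ℂ (n ^ min a a') (n ^ min b b') (n ^ min
c c')) : ℝ)) =O[Filter.atTop] (fun n : ℕ => (n : ℝ) ^ γ')) ∧ (∀ ε : ℝ, 0 < ε → ∃ k : ℕ, 1 ≤ k ∧ (fun
n : ℕ => (Literature.Computability.AlgebraicComplexity.tensorRank
(Literature.Computability.AlgebraicComplexity.matMulTensor ℂ n n (n ^ k)) : ℝ)) =O[Filter.atTop] fun
n : ℕ => (n : ℝ) ^ ((k : ℝ) + 1 + ε))`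

## Assembly
Ninety lines over MatrixMultiplicationExponent + FlatteningBound + KroneckerRank only (sorry-free in
Sketch.lean and glue.lean, axioms propext/Classical.choice/Quot.sound): E supplies, for each ε > 0,
some k ≥ 1 with β = k + 1 + ε/8 admissible for ⟨n,n,n^k⟩; the rotations
tensorRank_matMulTensor_rotate move that bound to the formats (k,1,1) and (1,k,1); SUBMOD at this
pair (slack ε/4) returns admissible γ for the join (k,k,1) and γ' for the meet (1,1,1) with γ + γ' ≤
2β + ε/4; flattening (mul_le_tensorRank_matMulTensor_left: n^k·n^k ≤ R⟨n^k,n^k,n⟩) forces γ ≥ 2k,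
and γ' ∈ admissibleExponents ℂ gives ω ≤ γ' (csInf_le, admissibleExponents_bddBelow) — the
TwoBetaBridge inline — hence ω ≤ 2 + ε/2 < 2 + ε; so ω ≤ 2, and 2 ≤ ω is the flattening bound
omega_two_le; ω(ℂ) = 2 is MatrixMultiplication (MatrixMultiplication_iff).

Rationale: WHY THIS LINE. The lever is a hidden lattice-positivity class of the rectangular exponent function:
every shape property in print is symmetry,
homogeneity, monotonicity or convexity/subadditivity (LottiRomani1983; doi:10.1006/jcom.1998.0476;
LeGall2012 §1), and the only
shape conjecture on record is log-convexity of Δ_m (BurgisserClausenShokrollahi1997 Problem 15.4;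
AlmanLi2026 = arXiv:2605.21738
§8) — an EXCHANGE inequality between two incomparable formats appears nowhere, yet the three deep
exact border ranks
bR⟨2,2,2⟩ = 7, bR⟨2,2,3⟩ = 10, bR⟨2,3,3⟩ = 14 (Landsberg2005, ConnerHarperLandsberg2023 Thm 1.3/1.4)
obey its finite shadow MRR2
(log-submodularity of border rank, 126/126 exactly-known lattice pairs in {1,2,3}³, 99 strictly)
while exact RANK breaks it
(R⟨2,2,3⟩·R⟨2,1,1⟩ = 22 > 21): the law lives at the border/asymptotic level where Kronecker
multiplicativity makes log scale
canonical. Imported from discrete convex analysis / matroid theory: submodularity on a product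
lattice (decreasing differences),
the Lovász-extension reading (ω = 2 iff h is the Lovász extension p₁+p₂+(ω−2)p₃, a polymatroid) and
laminarity of the Pareto
frontier of conv(log Δ_m) (two-leg exchanges only). Why easier than ω = 2 head-on: SUBMOD is an
axiom about the value function,
not an algorithm, so no catalogued fixed-tensor / group barrier contains it, and it has a finite,
falsifiable shadow attackable
today format by format with the tree's border-apolarity machinery for ⟨3,3,3⟩ (first open cell:
bR⟨3,3,3⟩ ≤ 19 versus
Smirnov2013's 20); E sits at the far-rectangular end where laser economies are largest (excess
0.1988 at k = 3,
VassilevskaWilliamsXuXuZhou2024 Table 1) and is strictly weaker than α = 1 (RectangularAlpha) since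
β ≤ 2 − α. Unlike EPRFaces,
which needs the LOCATION of an ω-maximising spectral point on a side face (bridge ω ≤ 1 + β), this
line assumes a global exchange
inequality with a finite checkable shadow (bridge ω ≤ 2β); the negatives index (6 refuted
statements, all STPP/design side) is
untouched.

RANKED CRUXES. #2 ShapeSubmodular (crux) — SUBMOD on the integer format lattice (card
shape-submodularity-border-mrr2, K1): for all natural a,b,c,a',b',c',
ω(max(a,a'),max(b,b'),max(c,c')) + ω(min(a,a'),min(b,b'),min(c,c')) ≤ ω(a,b,c) + ω(a',b',c'),
ω(a,b,c) = inf of the admissible β with R(⟨n^a,n^b,n^c⟩) = O(n^β) — FILED IN RANK FORM (rev 1):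
admissible β, β' for the two formats yield, for every ε > 0, admissible γ, γ' for join and meet with
γ + γ' ≤ β + β' + ε (equivalent to the omegaRect ℂ inequality: rectDim_natCast, csInf; no
vendored-table or CHL fact enters the route file's import cone). By homogeneity (omegaRect_smul)
this is SUBMOD on the rational lattice; equivalently the upper frontier of conv(log Δ_m) is laminar
(adjacent extremal spectral points trade two legs, never three). [difficulty: open-problem] (why it
might fail: a dark extremal spectral point joined to the frontier by a three-leg edge violates it;
with flattening-type lower bounds only (L submodular, L ≤ h ≤ U) it is unfalsifiable from below
today, and SUBMOD + α ≥ 0.3213 already forces ω ≤ 2β ≤ 2.4.) [LottiRomani1983,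
BurgisserClausenShokrollahi1997, arXiv:2605.21738, Strassen1988, doi:10.1006/jcom.1998.0476]
#3 PerfectAmortisation (crux) — E, perfect amortisation (the EPRFaces item
stmt-MatrixMultiplication-10893 verbatim, rank form): for every ε > 0 some natural k ≥ 1 has
R(⟨n,n,n^k⟩) = O(n^{k+1+ε}), i.e. inf_k [ω(1,1,k) − k − 1] = 0 — an n × n matrix is applied to a
stream of n^k vectors at cost n^{1+o(1)} per vector (β = 1). Under SUBMOD this IS the summit (1 + β
≤ ω ≤ 2β). [difficulty: open-problem] (why it might fail: best certified excess is 0.198809 at k = 3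
(VXXZ2024 Table 1) and fixed-q CW_q analyses may bottom out at c_q > 0; a module bound R(⟨n,n,N⟩) ≥
n^{1+c}·N (EPRFaces' ModuleRankGrowth) refutes it and ω = 2 with it.) [LeGall2012,
LeGallUrrutia2018, VassilevskaWilliamsXuXuZhou2024, LottiRomani1983,
ChristandlLeGallLysikovZuiddam2025]
#9 TwoBetaBridge (support) — the bridge in rank form, SUBMOD → ∀ k ≥ 1 ∀ β [R(⟨n,n,n^k⟩) = O(n^β) →
ω ≤ 2(β − k)] (i.e. ω ≤ 2(ω(1,1,k) − k)): rotate the bound to the formats (k,1,1) & (1,k,1)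
(tensorRank_matMulTensor_rotate), apply SUBMOD — join (k,k,1), meet (1,1,1) — to get admissible γ,
γ' with γ + γ' ≤ 2β + ε; flattening n^k·n^k ≤ R⟨n^k,n^k,n⟩ (mul_le_tensorRank_matMulTensor_left)
gives γ ≥ 2k and γ' ∈ admissibleExponents ℂ gives ω ≤ γ' (csInf_le, admissibleExponents_bddBelow).
Proved inline in the deciding theorem; filed so that printed far-rectangular bounds become
Lean-checked consequences of SUBMOD (k = 3 row of VXXZ2024: ω ≤ 2.397618). [difficulty:
provable-now] [LottiRomani1983, VassilevskaWilliamsXuXuZhou2024]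
#9 SubmodOfOmegaTwo (support) — necessity — ω(ℂ) = 2 → SUBMOD: if ω = 2 then ω(a,b,c) = max(a+b,
b+c, a+c) for all naturals (upper: blocking into ⌈n^a/n^c⌉⌈n^b/n^c⌉ square products of size n^c, c =
min, plus padding/monotonicity tensorRank_matMulTensor_mono₃; lower: flattening), and max of
pairwise sums = (a+b+c) − min(a,b,c) is submodular because min is supermodular on the lattice
(min(p∨q) + min(p∧q) ≥ min p + min q). Records that a refutation of ShapeSubmodular refutes the
summit. [difficulty: M] [LottiRomani1983, Blaser2013]
#9 BorderLogSubmodular (support) — MRR2, the finite law (card K2): border rank of matrix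
multiplication is log-submodular on the format lattice — for all positive formats,
bR⟨a∨a',b∨b',c∨c'⟩ · bR⟨a∧a',b∧b',c∧c'⟩ ≤ bR⟨a,b,c⟩ · bR⟨a',b',c'⟩ (bR = algBorderRank over ℂ[ε]);
equivalently every 2×2 minor of each border-rank table is ≤ 0 in log scale. Passes all 126
exactly-known incomparable pairs in {1,2,3}³ (27 equalities, 99 strict, tightest 98 ≤ 100); the rank
analogue is FALSE (R⟨2,2,3⟩·R⟨2,1,1⟩ = 11·2 > 7·3). Implies ShapeSubmodular (MRR2ImpliesSubmod) —
the foreseen layer-2 child of crux 2; refutable at one cube (bR⟨3,3,3⟩ = 20 kills it, SUBMOD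
survives). [difficulty: open-problem] [ConnerHarperLandsberg2023, Landsberg2005, Smirnov2013,
LandsbergGCT2017]
#9 MRR2ImpliesSubmod (support) — MRR2 → SUBMOD: apply MRR2 to the Kronecker powers
⟨2^{Na},2^{Nb},2^{Nc}⟩, ⟨2^{Na'},2^{Nb'},2^{Nc'}⟩ (join/meet commute with powers), take N-th roots
and N → ∞ using R̃(T) = lim_N bR(T^{⊠N})^{1/N} (AsymptoticRankBorderRank) and R̃(⟨2^a,2^b,2^c⟩) =
2^{ω(a,b,c)} for natural exponents (RectangularExponentAsymptoticRank). [difficulty: M]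
[Strassen1988, Blaser2013]
#9 CubeNineteen (support) — the first open cell of MRR2 and the route's cheapest falsifier:
bR⟨3,3,3⟩ ≤ 19 over ℂ[ε] (printed window [17,20]: ConnerHarperLandsberg2023 Thm 1.1, Smirnov2013; in
tree 16 ≤ · ≤ 20 proved, BorderRankMatMulThreeWindow). Closed by an explicit order-h approximate
scheme with 19 products; refuted by a border-apolarity proof of bR⟨3,3,3⟩ = 20 (the tree's ⟨3,3,3⟩
kernel-test pipeline, BorderRankMatMulThree*), which kills MRR2 at the first cube but not SUBMOD.
[difficulty: L] [Smirnov2013, ConnerHarperLandsberg2023, LandsbergGCT2017]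
#9 CubeNineteenOfMRR2 (support) — MRR2 at the pair (3,3,2) & (3,2,3) — join (3,3,3), meet (3,2,2) —
gives bR⟨3,3,3⟩·bR⟨3,2,2⟩ ≤ bR⟨3,3,2⟩·bR⟨3,2,3⟩; with the numeric hypotheses 10 ≤ bR⟨3,2,2⟩,
bR⟨3,3,2⟩ ≤ 14, bR⟨3,2,3⟩ ≤ 14 (stated inline since rev 1; they are CHL Thm 1.3, bR⟨2,2,3⟩ = 10, and
Thm 1.4, bR⟨2,3,3⟩ = 14, transported by algBorderRank_matMulTensor_rotate — the named facts
ConnerHarperLandsberg2023_thm_1_3 / _thm_1_4_233 stay out of the route file so its cone is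
fact-free; a Theorems file may discharge the hypotheses from them) this is 10·bR⟨3,3,3⟩ ≤ 196, i.e.
bR⟨3,3,3⟩ ≤ 19 (three lines: Nat.mul_le_mul, omega). [difficulty: provable-now]
[ConnerHarperLandsberg2023]

TWO-LAYER PLAN. ShapeSubmodular ⇐ BorderLogSubmodular → ShapeSubmodular (glue MRR2ImpliesSubmod,
filed as support) — the finite engine, attacked
cell by cell (CubeNineteen first; then bR⟨2,2,n⟩ ≥ 3n+1 for n ≥ 4, bR⟨2,3,4⟩ ≤ 18, bR⟨2,4,4⟩ ≤ 24);
alternatively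
ShapeSubmodular ⇐ LaminarFrontier (every edge of the upper frontier of conv(log Δ_m) is parallel to
a coordinate plane; spectral
form via Strassen duality) → ShapeSubmodular. PerfectAmortisation ⇐ its EPRFaces children (LaserTail
/ FaceUniversality /
RectExponentTwoEqThree), shared, not refiled here.

KILL CRITERIA. ¬ShapeSubmodular (a proved three-leg exchange violation among rectangular exponents)
refutes crux 2 AND the summit (SubmodOfOmegaTwo):
close `refuted:ShapeSubmodular` and hand the witness to BorderRankLowerBound as a
dark-spectral-point certificate. ¬PerfectAmortisation
(EPRFaces' ModuleRankGrowth proved) refutes crux 3 and the summit: close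
`refuted:PerfectAmortisation` jointly with EPRFaces. bR⟨3,3,3⟩ = 20
(¬CubeNineteen) kills only the finite law MRR2 at the first cube: drop
BorderLogSubmodular/CubeNineteen*, keep the route on SUBMOD and
re-aim the finite programme at formats ≥ 4 (MRR2 eventually). ω = 2 proved elsewhere moots the route
(both cruxes follow).

NOT DECOMPOSED YET. Continuity of omegaRect in all three arguments (needed to pass from the
integer/rational lattice to real SUBMOD; not load-bearing
for the assembly, which uses only the points (k,1,1), (1,k,1), (k,k,1), (1,1,1)); the spectral
(laminarity) form of SUBMOD and its
relation to Strassen's log-convexity Problem 15.4 (independent); any split of E (belongs to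
EPRFaces); the small-format cells of MRR2
beyond the cube (bR⟨2,2,4⟩ ∈ {12,13}, bR⟨2,3,4⟩, bR⟨2,4,4⟩) — layer-2 children later.

CHEAPEST FALSIFIER. The exact-value audit of MRR2 — RUN this session (compute/mrr2_audit.py, stdlib
python, seconds): all 126 incomparable pairs in
{1,2,3}³ with four exactly known border ranks (ab for ⟨a,b,1⟩-types, 7, 10, 14) pass, 27 with
equality, tightest ratio 100/98; the
same pairs with exact ranks (11, 15) give 9 violations (the delimiter). The one live cell is
CubeNineteen: a border-apolarity proof
that bR⟨3,3,3⟩ = 20 (CHL §7-style Borel-fixed census at r = 19; the tree already runs this pipeline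
at r = 17) kills MRR2 at the
cube — SUBMOD and the route survive, but lose their finite engine's first rung. No known lower-bound
technology can falsify SUBMOD
itself (flattening bounds are submodular), which is the honest weakness of crux 2.

NUMBERS. ω ≤ 2.371339 (AlmanDuanVassilevskaWilliamsXuXuZhou2025); α ≥ 0.321334, ω(1,2,1) ≤ 3.250385,
ω(1,3,1) ≤ 4.198809
(VassilevskaWilliamsXuXuZhou2024 Table 1, vendored in tree as the named fact
vxxz2024_omegaRect_table — NOT imported by this route file) ⇒ under SUBMOD ω ≤ 2(4.198809 − 3) =
2.397618 (Lean-checked form of TwoBetaBridge at k = 3); the card and its critic report Le Gall 2012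
Table 1 u(5) ≤ 6.166736 ⇒
ω ≤ 2.333472 < 2.371339 (NOT re-verified this session: the table is stripped from the held text
extraction of arXiv:1204.1111 —
flagged for the grounder). Always 1 + β ≤ ω (blocking, omegaRect_one_one_le_add) and, under SUBMOD,
ω ≤ 2β. Small formats:
bR⟨2,2,2⟩ = 7 (Landsberg2005), bR⟨2,2,3⟩ = 10, bR⟨2,3,3⟩ = 14, 17 ≤ bR⟨3,3,3⟩ ≤ 20
(ConnerHarperLandsberg2023, Smirnov2013; tree:
16 ≤ · ≤ 20 proved); MRR2 predicts bR⟨3,3,3⟩ ≤ 19, bR⟨2,3,4⟩ ≤ 18, bR⟨2,4,4⟩ ≤ 24, bR⟨n,2,2⟩ ≤ 3n +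
1. Items: 9
(2 cruxes, 6 supports, assembly); rev 1 (cone repair) restated ShapeSubmodular, TwoBetaBridge,
CubeNineteenOfMRR2 and the deciding theorem over MatrixMultiplicationExponent / FlatteningBound /
KroneckerRank / SchoenhageTau and dropped the imports RectangularExponent(+Homogeneity, Symmetry)
and BorderRankMatMulSmall: import cone 115 → 8 project modules, unproved named facts in it 7 → 0.

DEFINITION REQUESTS. None: tensorRank, matMulTensor, admissibleExponents, omega
(MatrixMultiplicationExponent) and algBorderRank (SchoenhageTau) are all the route file uses;
omegaRect / rectDim (RectangularExponent) and the CHL named facts (BorderRankMatMulSmall) exist in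
Literature.Computability.AlgebraicComplexity and are the DICTIONARY for Theorems files
(rectDim_natCast: rectAdmissibleExponents ℂ a b c at natural exponents is exactly the rank-form
O-bound set), deliberately not imported here. Cite-fact wanted (grounder): Le Gall 2012 Table 1 rows
k = 4, 5 (doi:10.1109/focs.2012.80)
and Le Gall–Urrutia 2018 Table 3 (arXiv:1708.05622), to sharpen the conditional consequence of
TwoBetaBridge.

Novelty: Searches (2026-08-16): `lit search --source crossref "submodular rectangular matrix multiplication
exponent"` (8 rows: Pan 1984, LeGall2012,
HuangPan 1998, LottiRomani1983, CLLZ 2025 — none with a lattice/exchange property); `lit search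
--source crossref "log-concave border rank
matrix multiplication tensor format lattice"` (8 rows, irrelevant: LandsbergMichalek2018,
tensor-completion papers); `lit search --source
zbmath/arxiv` same queries (0 rows); `lit galaxy search "rectangular matrix multiplication" --star
all` and `"exponent of rectangular matrix
multiplication" --star pdf` (12 + 3 rows, fine-grained-complexity papers, no shape axioms); `lit
frontier MatrixMultiplication --since 2024`
(40 rows; shape-relevant: Wigderson–Zuiddam Bull. AMS 2026 doi:10.1090/bull/1880 (survey,
paywalled), arXiv:2605.21738 §8 (convexity as
the extra axiom), arXiv:2601.21553 (support = quantum functionals), arXiv:2601.08119 (numerical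
census of R̃), arXiv:2606.13408 (rank-only
catalog: no new border ranks)); `lit read arxiv:1204.1111`, `arxiv:1708.05622` (grep for
far-rectangular rows: tables stripped; ω(3) ≤
4.199712 < 4.207372 found in text); local searchd/hybrid DOWN (ConnectionReset ×2) and OpenAlex 429
— logged; the card's own searches
(2026-08-15: crossref ×2, galaxy "submodular" --star all, BCS/Landsberg2017/LR83 page reads) and its
mechanism critic's (galaxy pdf
intelligent on shape inequalities, zbMATH) found nothing lattice-theoretic either. Hub: 62 route
files grepped for "submodul  [refs: 10.1090/bull/1880, 10.1016/0304-3975(83, 2605.21738, 2601.21553, 2601.08119, 2606.13408, 1204.1111, 1708.05622, 1911.07981, doi:10.1090/bull/1880, arxiv:1204.1111, arxiv:1708.05622, doi:10.1016/0304-3975, LeGall2012, LottiRomani1983, LandsbergMichalek2018, Landsberg2017, BurgisserClausenShokrollahi1997]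

Barriers (technique_class: spectrum-shape, lattice-submodularity, rect-mm): - technique_class: spectrum-shape, lattice-submodularity, rect-mm
- Literature.Barriers.MatrixMultiplication.RectangularBarrier: not in class for crux 2 (no T-method
is run; SUBMOD consumes rectangular bounds only as numbers). It DOES apply to crux 3 if E is
attempted with CW_q powers at a fixed k (Thm 3.15 caps per k), inherited from EPRFaces; its cap on
the excess ω̂(k) − (k+1) for CW_q tends to 0 as k → ∞ ((1−θ₁)·log R̃/log ζ^θ ≤ 1 with equality only
at flattening-tight θ), so the entry forces k → ∞ but does not exclude E.
- Literature.Barriers.MatrixMultiplication.InfimumNotMinimumBarrier: respected — SUBMOD and E are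
asymptotic statements and MRR2 is an infinite family of inequalities; no single format is asked to
certify an exponent (CubeNineteen claims nothing about ω).
- Literature.Barriers.MatrixMultiplication.IrreversibilityBarrier: not in class (no intermediate
tensor); relevant only downstream if E is attacked through a fixed irreversible carrier — then
inherited as for RectangularBarrier.
- Literature.Barriers.MatrixMultiplication.UniversalMethodBarrier: not in class for the same reason;
a universal-method proof of E from CW_q would have to beat ω_u(CW_q) ≥ 2.168 only in the
far-rectangular normalisation, which the entry does not price.
- Literature.Barriers.MatrixMultiplication.UnstableTensorBarrier: not in class (no structure tensor
of an algebra / minimal-border-rank carrier is used).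
- Literature.Barriers.MatrixMultiplication.LinearRankMethodBarrier: bears on

History (route lifecycle, newest last):
- 2026-08-16T15:14:06Z · rev 1: restated CubeNineteenOfMRR2 (stmt-MatrixMultiplication-15148) — cone repair 1/4: CubeNineteenOfMRR2 restated with inline numeric hypotheses (10 ≤ bR⟨3,2,2⟩, bR⟨3,3,2⟩ ≤ 14, bR⟨3,2,3⟩ ≤ 14) instead of the cite-only named fact (planner-rrepair-MatrixMultiplication-ShapeSubm-46a2e293-0)
- 2026-08-16T15:14:28Z · rev 2: restated ShapeSubmodular (stmt-MatrixMultiplication-15143) — cone repair 2/4: ShapeSubmodular restated in RANK FORM (omegaRect unfolded into the O-bounds on tensorRank (matMulTensor ℂ (n^a) (n^b) (n^c)); inf handled as ∀β (planner-rrepair-MatrixMultiplication-ShapeSubm-46a2e293-0)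
- 2026-08-16T15:14:44Z · rev 3: restated TwoBetaBridge (stmt-MatrixMultiplication-15144) — cone repair 3/4: TwoBetaBridge restated in rank form (SUBMOD → ∀ k ≥ 1 ∀ β, R(⟨n,n,n^k⟩) = O(n^β) → ω ≤ 2(β − k)) over omega/tensorRank/matMulTensor only — the (planner-rrepair-MatrixMultiplication-ShapeSubm-46a2e293-0)
- 2026-08-17T13:39:29Z · skeleton.hides-summit: stub_coreExchange (stmt-MatrixMultiplication-15622) ⟷ summit (accepted theorem in Summits/MatrixMultiplication/MatrixMultiplication/Theorems/ShapeSubmodularityShapeSubmodularSummitEquivalence.lean) (prover-line-stmt-MatrixMultiplication-15622-c5-0)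
- 2026-08-17T14:08:24Z · CLOSED superseded — superseded:route-MatrixMultiplication-CubicExchangeSplit (planner-rbadge-MatrixMultiplication-ShapeSubmo-46a2e293-0)

sub-problem: MatrixMultiplication · status: closed(superseded) · opened planner-plan-novel-MatrixMultiplication-MatrixM-c775de46-g2-0 2026-08-16T14:44:27Z · rev 4 · ledger route-MatrixMultiplication-ShapeSubmodularity
GENERATED by the gate from the ledger (D-0016/17). Provers cite these decls: `theorem foo : Summit.MatrixMultiplication.MatrixMultiplication.Theses.ShapeSubmodularity.<Decl> := …` in Summits/MatrixMultiplication/MatrixMultiplication/Theorems/<Name>.lean.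
-/

namespace Summit.MatrixMultiplication.MatrixMultiplication.Theses.ShapeSubmodularity

open scoped BigOperators Topology Manifold Classical MeasureTheory ProbabilityTheory Matrix InnerProductSpace ComplexConjugate ContinuousMap
open Filter Set Function TopologicalSpace MeasureTheory

attribute [summit_statement] _root_.MatrixMultiplication

-- earlier ShapeSubmodular (stmt-MatrixMultiplication-15143, replaced 2026-08-16T15:14:28Z -> stmt-MatrixMultiplication-15622): retired by None — ∀ a b c a' b' c' : ℕ, Literature.Computability.AlgebraicComplexity.omegaRect ℂ ((max a a' : ℕ) : ℝ) ((max b b' : ℕ) : ℝ) ((max c c' : ℕ) : ℝ) + Literature.Computability.AlgebraicComplexity.omegaRect ℂ ((min a a' : ℕ) : ℝ) ((min b b' : ℕ) : ℝ) ((min c c' : ℕ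
/-- item stmt-MatrixMultiplication-15622 · crux · rank 2 · closed · moot by None · by planner
why it might fail: a dark extremal spectral point joined to the frontier by a three-leg edge violates it; with flattening-type lower bounds only (L submodular, L ≤ h ≤ U) it is unfalsifiable from below today, and SUBMOD + α ≥ 0.3213 already forces ω ≤ 2β ≤ 2.4.
sources: LottiRomani1983, BurgisserClausenShokrollahi1997, arXiv:2605.21738, Strassen1988, doi:10.1006/jcom.1998.0476
[crux] SUBMOD on the integer format lattice (card shape-submodularity-border-mrr2, K1), RANK FORM
(rev 1, cone repair): for all natural a,b,c,a',b',c', all real β, β' with R(⟨n^a,n^b,n^c⟩) = O(n^β)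
and R(⟨n^a',n^b',n^c'⟩) = O(n^β') (R = tensorRank ∘ matMulTensor ℂ), and every ε > 0 there are γ, γ'
with γ + γ' ≤ β + β' + ε, R(⟨n^(a∨a'),n^(b∨b'),n^(c∨c')⟩) = O(n^γ) and
R(⟨n^(a∧a'),n^(b∧b'),n^(c∧c')⟩) = O(n^γ'). Equivalent to ω(p∨q) + ω(p∧q) ≤ ω(p) + ω(q) with ω(a,b,c)
= omegaRect ℂ a b c, the infimum of exactly these admissible exponents (each admissible set is
non-empty, bounded below and upward closed; rectDim_natCast) — 'the three dimensions are
substitutes': aligning two formats never increases total exponent cost. By homogeneity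
(omegaRect_smul) this is SUBMOD on the rational lattice; equivalently the upper frontier of conv(log
Δ_m) is laminar (adjacent extremal spectral points trade two legs, never three). [difficulty:
open-problem] -/
@[route_item "route-MatrixMultiplication-ShapeSubmodularity"]
def ShapeSubmodular : Prop :=
  ∀ a b c a' b' c' : ℕ, ∀ β β' : ℝ, (fun n : ℕ => (Literature.Computability.AlgebraicComplexity.tensorRank (Literature.Computability.AlgebraicComplexity.matMulTensor ℂ (n ^ a) (n ^ b) (n ^ c)) : ℝ)) =O[Filter.atTop] (fun n : ℕ => (n : ℝ) ^ β) → (fun n : ℕ => (Literature.Computability.AlgebraicComplexity.tensorRank (Literature.Computability.AlgebraicComplexity.matMulTensor ℂ (n ^ a') (n ^ b') (n ^ c')) : ℝ)) =O[Filter.atTop] (fun n : ℕ => (n : ℝ) ^ β') → ∀ ε : ℝ, 0 < ε → ∃ γ γ' : ℝ, γ + γ' ≤ β + β' + ε ∧ (fun n : ℕ => (Literature.Computability.AlgebraicComplexity.tensorRank (Literature.Computability.AlgebraicComplexity.matMulTensor ℂ (n ^ max a a') (n ^ max b b') (n ^ max c c')) : ℝ)) =O[Filter.atTop] (fun n : ℕ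 => (n : ℝ) ^ γ) ∧ (fun n : ℕ => (Literature.Computability.AlgebraicComplexity.tensorRank (Literature.Computability.AlgebraicComplexity.matMulTensor ℂ (n ^ min a a') (n ^ min b b') (n ^ min c c')) : ℝ)) =O[Filter.atTop] (fun n : ℕ => (n : ℝ) ^ γ')

/-- item stmt-MatrixMultiplication-10893 · crux · rank 3 · closed · proved by Summit.MatrixMultiplication.MatrixMultiplication.Theorems.PerfectAmortisation.perfectAmortisation_proof @ a58f4dd2b2be (prover) · by planner
why it might fail: best certified excess is 0.198809 at k = 3 (VXXZ2024 Table 1) and fixed-q CW_q analyses may bottom out at c_q > 0; a module bound R(⟨n,n,N⟩) ≥ n^{1+c}·N (EPRFaces' ModuleRankGrowth) refutes it and ω = 2 with it.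
sources: LeGall2012, LeGallUrrutia2018, VassilevskaWilliamsXuXuZhou2024, LottiRomani1983, ChristandlLeGallLysikovZuiddam2025
[crux] E, the card's face statement in form (i): e(∞) = lim_k [ω(1,1,k) − k − 1] = 0, filed in RANK
FORM as ∀ ε > 0 ∃ k ≥ 1, R(⟨n,n,n^k⟩) = O(n^{k+1+ε}) with R(⟨n,n,n^k⟩) = tensorRank (matMulTensor ℂ
n n (n^k)); equivalent to ∀ ε ∃ k, ω(1,1,k) ≤ k + 1 + ε (ω(1,1,k) = omegaRect ℂ 1 1 k is the inf of
exactly these β since ⌈n^k⌉ = n^k; the ε-slack is absorbed by the quantifiers; e(k) ≥ 0 and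
nonincreasing by add_one_le_omegaRect_one_mid_one, omegaRect_one_mid_one, omegaRect_one_one_le_add,
so lim = inf = 0). Equivalent forms: the module rank / border rank per vector ρ(n), β(n) are
n^{1+o(1)} (log_n β(n) ≥ 1 + e(∞) for every n by a tensor-power argument); no universal spectral
point on a side face of Strassen's chart beyond the base edge (h = 1). [difficulty: open-problem] -/
@[route_item "route-MatrixMultiplication-ShapeSubmodularity"]
def PerfectAmortisation : Prop :=
  ∀ ε : ℝ, 0 < ε → ∃ k : ℕ, 1 ≤ k ∧ (fun n : ℕ => (Literature.Computability.AlgebraicComplexity.tensorRank (Literature.Computability.AlgebraicComplexity.matMulTensor ℂ n n (n ^ k)) : ℝ)) =O[Filter.atTop] fun n : ℕ => (n : ℝ) ^ ((k : ℝ) + 1 + ε)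

/-- item stmt-MatrixMultiplication-15145 · support · rank 9 · closed · moot by None · by planner
sources: LottiRomani1983, Blaser2013
[support] necessity — ω(ℂ) = 2 → SUBMOD: if ω = 2 then ω(a,b,c) = max(a+b, b+c, a+c) for all
naturals (upper: blocking into ⌈n^a/n^c⌉⌈n^b/n^c⌉ square products of size n^c, c = min, plus
padding/monotonicity tensorRank_matMulTensor_mono₃; lower: flattening), and max of pairwise sums =
(a+b+c) − min(a,b,c) is submodular because min is supermodular on the lattice (min(p∨q) + min(p∧q) ≥
min p + min q). Records that a refutation of ShapeSubmodular refutes the summit. [difficulty: M] -/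
@[route_item "route-MatrixMultiplication-ShapeSubmodularity"]
def SubmodOfOmegaTwo : Prop :=
  MatrixMultiplication → ShapeSubmodular

/-- item stmt-MatrixMultiplication-15146 · support · rank 9 · closed · moot by None · by planner
sources: ConnerHarperLandsberg2023, Landsberg2005, Smirnov2013, LandsbergGCT2017
[support] MRR2, the finite law (card K2): border rank of matrix multiplication is log-submodular on
the format lattice — for all positive formats, bR⟨a∨a',b∨b',c∨c'⟩ · bR⟨a∧a',b∧b',c∧c'⟩ ≤ bR⟨a,b,c⟩ ·
bR⟨a',b',c'⟩ (bR = algBorderRank over ℂ[ε]); equivalently every 2×2 minor of each border-rank table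
is ≤ 0 in log scale. Passes all 126 exactly-known incomparable pairs in {1,2,3}³ (27 equalities, 99
strict, tightest 98 ≤ 100); the rank analogue is FALSE (R⟨2,2,3⟩·R⟨2,1,1⟩ = 11·2 > 7·3). Implies
ShapeSubmodular (MRR2ImpliesSubmod) — the foreseen layer-2 child of crux 2; refutable at one cube
(bR⟨3,3,3⟩ = 20 kills it, SUBMOD survives). [difficulty: open-problem] -/
@[route_item "route-MatrixMultiplication-ShapeSubmodularity", crux]
def BorderLogSubmodular : Prop :=
  ∀ a b c a' b' c' : ℕ, 1 ≤ a → 1 ≤ b → 1 ≤ c → 1 ≤ a' → 1 ≤ b' → 1 ≤ c' → Literature.Computability.AlgebraicComplexity.algBorderRank (Literature.Computability.AlgebraicComplexity.matMulTensor ℂ (max a a') (max b b') (max c c')) * Literature.Computability.AlgebraicComplexity.algBorderRank (Literature.Computability.AlgebraicComplexity.matMulTensor ℂ (min a a') (min b b') (min c c')) ≤ Literature.Computability.AlgebraicComplexity.algBorderRank (Literature.Computability.AlgebraicComplexity.matMulTensor ℂ a b c) * Literature.Computability.AlgebraicComplexity.algBorderRank (Literature.Computability.AlgebraicComplexity.matMulTensor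 ℂ a' b' c')

/-- item stmt-MatrixMultiplication-15147 · support · rank 9 · closed · moot by None · by planner
sources: Strassen1988, Blaser2013
[support] MRR2 → SUBMOD: apply MRR2 to the Kronecker powers ⟨2^{Na},2^{Nb},2^{Nc}⟩,
⟨2^{Na'},2^{Nb'},2^{Nc'}⟩ (join/meet commute with powers), take N-th roots and N → ∞ using R̃(T) =
lim_N bR(T^{⊠N})^{1/N} (AsymptoticRankBorderRank) and R̃(⟨2^a,2^b,2^c⟩) = 2^{ω(a,b,c)} for natural
exponents (RectangularExponentAsymptoticRank). [difficulty: M] -/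
@[route_item "route-MatrixMultiplication-ShapeSubmodularity"]
def MRR2ImpliesSubmod : Prop :=
  BorderLogSubmodular → ShapeSubmodular

-- earlier CubeNineteenOfMRR2 (stmt-MatrixMultiplication-15148, replaced 2026-08-16T15:14:06Z -> stmt-MatrixMultiplication-15594): retired by None — BorderLogSubmodular → Literature.Computability.AlgebraicComplexity.ConnerHarperLandsberg2023_thm_1_3 → Literature.Computability.AlgebraicComplexity.ConnerHarperLandsberg2023_thm_1_4_233 → Literature.Computability.AlgebraicComplexity.algBorderRank (Litera
/-- item stmt-MatrixMultiplication-15594 · support · rank 9 · closed · moot by None · by planner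
sources: ConnerHarperLandsberg2023
[support] MRR2 at the pair (3,3,2) & (3,2,3) — join (3,3,3), meet (3,2,2): bR⟨3,3,3⟩·bR⟨3,2,2⟩ ≤
bR⟨3,3,2⟩·bR⟨3,2,3⟩; with the inline numeric hypotheses 10 ≤ bR⟨3,2,2⟩, bR⟨3,3,2⟩ ≤ 14, bR⟨3,2,3⟩ ≤
14 (these are ConnerHarperLandsberg2023 Thm 1.3, bR⟨2,2,3⟩ = 10, and Thm 1.4, bR⟨2,3,3⟩ = 14, up to
algBorderRank_matMulTensor_rotate; the named facts are kept OUT of the route file since rev 1 so its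
cone stays fact-free — a Theorems file may discharge the hypotheses from them) this is 10·bR⟨3,3,3⟩
≤ 196, i.e. bR⟨3,3,3⟩ ≤ 19 (Nat.mul_le_mul_left, Nat.mul_le_mul, omega; checked in the planner's
Sketch.lean). [difficulty: provable-now] -/
@[route_item "route-MatrixMultiplication-ShapeSubmodularity"]
def CubeNineteenOfMRR2 : Prop :=
  BorderLogSubmodular → 10 ≤ Literature.Computability.AlgebraicComplexity.algBorderRank (Literature.Computability.AlgebraicComplexity.matMulTensor ℂ 3 2 2) → Literature.Computability.AlgebraicComplexity.algBorderRank (Literature.Computability.AlgebraicComplexity.matMulTensor ℂ 3 3 2) ≤ 14 → Literature.Computability.AlgebraicComplexity.algBorderRank (Literature.Computability.AlgebraicComplexity.matMulTensor ℂ 3 2 3) ≤ 14 → Literature.Computability.AlgebraicComplexity.algBorderRank (Literature.Computability.AlgebraicComplexity.matMulTensor ℂ 3 3 3) ≤ 19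

-- earlier TwoBetaBridge (stmt-MatrixMultiplication-15144, replaced 2026-08-16T15:14:44Z -> stmt-MatrixMultiplication-15631): retired by None — ShapeSubmodular → ∀ k : ℕ, 1 ≤ k → Literature.Computability.AlgebraicComplexity.omega ℂ ≤ 2 * (Literature.Computability.AlgebraicComplexity.omegaRect ℂ 1 1 (k : ℝ) - (k : ℝ))
/-- item stmt-MatrixMultiplication-15631 · support · rank 9 · closed · moot by None · by planner
sources: LottiRomani1983, VassilevskaWilliamsXuXuZhou2024
[support] the bridge in rank form: SUBMOD → ∀ k ≥ 1 ∀ β, R(⟨n,n,n^k⟩) = O(n^β) → ω ≤ 2(β − k) (i.e.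
ω ≤ 2(ω(1,1,k) − k)): rotate the bound to the formats (k,1,1) & (1,k,1)
(tensorRank_matMulTensor_rotate); SUBMOD at this pair gives admissible γ for the join (k,k,1) and γ'
for the meet (1,1,1) with γ + γ' ≤ 2β + ε; flattening n^k·n^k ≤ R⟨n^k,n^k,n⟩
(mul_le_tensorRank_matMulTensor_left) gives γ ≥ 2k, and γ' ∈ admissibleExponents ℂ gives ω ≤ γ'
(csInf_le, admissibleExponents_bddBelow). Proved inline in the deciding theorem (copy it out); filed
so that printed far-rectangular bounds become Lean-checked consequences of SUBMOD (k = 3 row of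
VXXZ2024, ω(1,1,3) ≤ 4.198809: ω ≤ 2.397618). [difficulty: provable-now] -/
@[route_item "route-MatrixMultiplication-ShapeSubmodularity"]
def TwoBetaBridge : Prop :=
  ShapeSubmodular → ∀ k : ℕ, 1 ≤ k → ∀ β : ℝ, (fun n : ℕ => (Literature.Computability.AlgebraicComplexity.tensorRank (Literature.Computability.AlgebraicComplexity.matMulTensor ℂ n n (n ^ k)) : ℝ)) =O[Filter.atTop] (fun n : ℕ => (n : ℝ) ^ β) → Literature.Computability.AlgebraicComplexity.omega ℂ ≤ 2 * (β - (k : ℝ))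

/-- item stmt-MatrixMultiplication-8008 · support · rank 9 · open · by planner
sources: Smirnov2013, ConnerHarperLandsberg2023, LandsbergGCT2017
[crux] bR(⟨3,3,3⟩) ≤ 19 over ℂ[ε] (card C2; format 9×9×9). Window [17,20]: 17 by border apolarity
(ConnerHarperLandsberg2023), 20 by Smirnov2013 (numerical then exact), 21 = Schönhage's order-2
pattern (BCS Ex. 15.8). Engine: patterns of order h ≤ 2 with a stabiliser of order ≥ 3 in (S_3 ≀
transpose/cyclic) × torus — the border analogue of the symmetric-scheme searches; a 19 reads ω ≤
log_27 19³ = 2.68 and is the first movement at 3×3 since 2013. [deps: TwoSquaresThirteen]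
[difficulty: open-problem] -/
@[route_item "route-MatrixMultiplication-ShapeSubmodularity"]
def CubeNineteen : Prop :=
  Literature.Computability.AlgebraicComplexity.algBorderRank (Literature.Computability.AlgebraicComplexity.matMulTensor ℂ 3 3 3) ≤ 19

/-- item stmt-MatrixMultiplication-15149 · assembly · rank 1 · closed · moot by None · by planner
sources: LottiRomani1983, LeGall2012, Blaser2013
[assembly] ShapeSubmodular → PerfectAmortisation → ω(ℂ) = 2. -/
@[route_item "route-MatrixMultiplication-ShapeSubmodularity"]
def Assembly : Prop :=
  ShapeSubmodular → PerfectAmortisation → MatrixMultiplication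

end Summit.MatrixMultiplication.MatrixMultiplication.Theses.ShapeSubmodularity
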